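import Summits.Parity.GeneralizedHardyLittlewood.Theorems.BeyondDiagonalBeatsQuarter.OffDiagFlatness
import HarnessLib

/-!
# Route `PrimeLevelFamEdge`, crux K_B (stmt-Parity-20343), line `diagonal_kernel_split` rev 4, plan Ω,
# node L7b (OMEGA-BLUEPRINT v4 §3c) `OffDiagFlatness`, part 2 of 2: **aggregation over the outer indices —
# `Σ_{a mod h} (Σ_τ Σ_{β ↦ a} v_τ β)² ≤ (Σ_τ κ_τ √(1 + log B_τ + 8B_τ/h))²`, and the bilinear `(l, m)` form
# `Σ_{c ∈ (ℤ/h)ˣ} (Σ_{l,m: t·l·m ≡ c} x_l y_m)² ≤ (Σ_l x_l)²·κ²·(1 + log M + 8M/h)`**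

Part 1 (`OffDiagFlatness`) bounds the `ℓ²`-mass over the classes mod `h` of ONE running variable `β ∈ [1,B]` with
weights `0 ≤ v ≤ κβ^{-1/2}`. A source of the K_B dual core is `(τ, β)` with an outer index
`τ = (r, d₁, d₂, i, s, l, …)` and the running variable `β` (e.g. `m/d₂`), landing in the class `φ_τ(β mod h)` for an
INJECTIVE `φ_τ` (a unit multiplier `β ↦ −(l/d₁)((r+1)s)⁻¹·β`; for the `s`-variable the permutation `ρ ↦ u ρ⁻¹` on
units). Minkowski in `ℓ²((ℤ/h))` over `τ` turns the one-variable bound into the bound for the class aggregate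
`W(a) = Σ_τ Σ_{β ↦ a} v_τ(β)` that node L7a's Cauchy–Schwarz consumes (`‖W‖₂`), losing nothing against the flat
size `‖W‖₁²/h` beyond part 1's factor.

* `sum_sq_sum_le_sq_sum` (Minkowski, squared: `Σ_a (Σ_τ f_τ a)² ≤ (Σ_τ b_τ)²` if `Σ_a f_τ² ≤ b_τ²`),
  `sum_sq_fiber_eq_of_injective` (re-indexing a square sum along an injective map),
  `sum_filter_comp_eq_sum_fiber` (regrouping the running variable by residues);
* **`sum_sq_aggregate_le`** (general injective `φ_τ`), `sum_sq_aggregate_mul_le` (unit multipliers),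
  `sum_norm_sq_aggregate_mul_le` (complex weights `‖c_τ(β)‖ ≤ κ_τ β^{-1/2}`), `sum_aggregate_eq` (the `ℓ¹` mass
  `Σ_a W(a) = Σ_τ Σ_β v`), `sum_units_le_sum_zmod` (restriction to the reduced classes `(ℤ/h)ˣ`, the indexing of
  `sum_units_norm_sq_largePart_eq`);
* **`sum_units_sq_bilinear_le`** — the `(l, m)` form: `x_l ≥ 0` on `[1,L]`, `0 ≤ y_m ≤ κ m^{-1/2}` on `[1,M]`,
  `t` a unit: `Σ_{c ∈ (ℤ/h)ˣ} (Σ_{l ≤ L} Σ_{m ≤ M, t l m ≡ c} x_l y_m)² ≤ (Σ_l x_l)²·κ²·(1 + log M + 8M/h)`; with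
  `x_l = |c_l|·sup|Φ̂|`, `y_m = |c_m|` (`norm_mollifierCoeff_le`) the flatness count of OMEGA-BLUEPRINT v4 §3c for
  one modulus (flat size `(Σx)²·4κ²M/h`; loss factor `2 + h(1 + log M)/(4M)`, i.e. `O(1)` for `h ≲ M/log M` and
  `≲ h/M` beyond — the `+M` of `#{(l,m) ≤ M : lm ≡ b (h)} ≤ M²/h + M`).
How L7d instantiates (`τ`, `B_τ`, `κ_τ = |c_l|·sup_{box}|Φ̂|·d₂^{-1/2}`, the moduli range) is not fixed here. Pure
finite inequalities, no definition; helper toward `stub_offDiagBelowSlack_io` (`--supports stmt-Parity-20343`);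
closes nothing; standard axioms.
«The programme SEARCHES and TYPES; no claim about Landau–Siegel zeros, Theorems 1–2 of arXiv:2211.02515 or
a repaired Margin232 until a kernel theorem says so.»
-/

noncomputable section

namespace Summit.Parity.GeneralizedHardyLittlewood.Theorems.BeyondDiagonalBeatsQuarter.OffDiag

open Finset Real

/-! ### §3. Minkowski in `ℓ²` and re-indexing by an injective class map -/

section Aggregate

/-- **Minkowski in `ℓ²` over a finite index type**, squared form: if `Σ_a f_τ(a)² ≤ b_τ²` with `b_τ ≥ 0` for every
`τ ∈ T`, then `Σ_a (Σ_{τ ∈ T} f_τ(a))² ≤ (Σ_{τ ∈ T} b_τ)²` (expand both squares and use Cauchy–Schwarz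
`Σ_a f_τ f_τ' ≤ b_τ b_τ'` termwise). [folklore] -/
theorem sum_sq_sum_le_sq_sum {α ι : Type*} [Fintype α] (T : Finset ι) (f : ι → α → ℝ) (b : ι → ℝ)
    (hb0 : ∀ τ ∈ T, 0 ≤ b τ) (hb : ∀ τ ∈ T, ∑ a, f τ a ^ 2 ≤ b τ ^ 2) :
    ∑ a, (∑ τ ∈ T, f τ a) ^ 2 ≤ (∑ τ ∈ T, b τ) ^ 2 := by
  have hcs : ∀ τ ∈ T, ∀ τ' ∈ T, ∑ a, f τ a * f τ' a ≤ b τ * b τ' := by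
    intro τ hτ τ' hτ'
    have h1 := Finset.sum_mul_sq_le_sq_mul_sq Finset.univ (f τ) (f τ')
    have h2 : (∑ a, f τ a * f τ' a) ^ 2 ≤ (b τ * b τ') ^ 2 := by
      rw [mul_pow]
      exact h1.trans (mul_le_mul (hb τ hτ) (hb τ' hτ') (Finset.sum_nonneg fun a _ => sq_nonneg _)
        (sq_nonneg _))
    exact (abs_le_of_sq_le_sq' h2 (mul_nonneg (hb0 τ hτ) (hb0 τ' hτ'))).2
  calc ∑ a, (∑ τ ∈ T, f τ a) ^ 2 = ∑ a, ∑ τ ∈ T, ∑ τ' ∈ T, f τ a * f τ' a :=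
        Finset.sum_congr rfl fun a _ => by rw [sq, Finset.sum_mul_sum]
    _ = ∑ τ ∈ T, ∑ τ' ∈ T, ∑ a, f τ a * f τ' a := by
        rw [Finset.sum_comm]
        exact Finset.sum_congr rfl fun τ _ => Finset.sum_comm
    _ ≤ ∑ τ ∈ T, ∑ τ' ∈ T, b τ * b τ' :=
        Finset.sum_le_sum fun τ hτ => Finset.sum_le_sum fun τ' hτ' => hcs τ hτ τ' hτ'
    _ = (∑ τ ∈ T, b τ) ^ 2 := by rw [sq, Finset.sum_mul_sum]

/-- **Re-indexing a square sum along an injective map**: the fibres of an injective `φ : α → γ` have at most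
one element, so `Σ_{a : γ} (Σ_{ρ : φ ρ = a} V ρ)² = Σ_ρ V(ρ)²`. [folklore] -/
theorem sum_sq_fiber_eq_of_injective {α γ : Type*} [Fintype α] [Fintype γ] [DecidableEq γ] {φ : α → γ}
    (hφ : Function.Injective φ) (V : α → ℝ) :
    ∑ a : γ, (∑ ρ ∈ (Finset.univ : Finset α).filter (fun ρ => φ ρ = a), V ρ) ^ 2 = ∑ ρ, V ρ ^ 2 := by
  classical
  have hfib : ∀ a : γ, (∑ ρ ∈ (Finset.univ : Finset α).filter (fun ρ => φ ρ = a), V ρ) ^ 2 =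
      ∑ ρ ∈ (Finset.univ : Finset α).filter (fun ρ => φ ρ = a), V ρ ^ 2 := by
    intro a
    set s := (Finset.univ : Finset α).filter (fun ρ => φ ρ = a) with hs
    have hcard : ∀ x ∈ s, ∀ y ∈ s, x = y := fun x hx y hy =>
      hφ ((Finset.mem_filter.1 hx).2.trans (Finset.mem_filter.1 hy).2.symm)
    rcases s.eq_empty_or_nonempty with hse | ⟨x, hx⟩
    · simp [hse]
    · have hsx : s = {x} := Finset.eq_singleton_iff_unique_mem.2 ⟨hx, fun y hy => hcard y hy x hx⟩
      simp [hsx]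
  simp_rw [hfib]
  exact Finset.sum_fiberwise Finset.univ φ (fun ρ => V ρ ^ 2)

/-- The inner sum of an aggregate regrouped by the residue of the running variable:
`Σ_{β ∈ [1,B], φ(β mod h) = a} v β = Σ_{ρ : φ ρ = a} Σ_{β ∈ [1,B], β ≡ ρ} v β`. [folklore] -/
theorem sum_filter_comp_eq_sum_fiber {h : ℕ} [NeZero h] (φ : ZMod h → ZMod h) (B : ℕ) (v : ℕ → ℝ)
    (a : ZMod h) :
    ∑ β ∈ (Icc 1 B).filter (fun β : ℕ => φ (β : ZMod h) = a), v β =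
      ∑ ρ ∈ (Finset.univ : Finset (ZMod h)).filter (fun ρ => φ ρ = a),
        ∑ β ∈ (Icc 1 B).filter (fun β : ℕ => (β : ZMod h) = ρ), v β := by
  classical
  rw [Finset.sum_fiberwise_eq_sum_filter (Icc 1 B) ((Finset.univ : Finset (ZMod h)).filter (fun ρ => φ ρ = a))
    (fun β : ℕ => (β : ZMod h)) v]
  refine Finset.sum_congr ?_ fun _ _ => rfl
  ext β
  simp

/-- **Flatness of an aggregate of sources (general injective class maps).** Sources `(τ, β)`, `τ ∈ T`,
`β ∈ [1, B_τ]`, land in the class `φ_τ(β mod h)` with weight `v_τ(β)`, where each `φ_τ : ZMod h → ZMod h` is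
injective and `0 ≤ v_τ(β) ≤ κ_τ β^{-1/2}` (`κ_τ ≥ 0`). Then the class aggregate
`W(a) = Σ_{τ ∈ T} Σ_{β : φ_τ(β) = a} v_τ(β)` has
`Σ_{a mod h} W(a)² ≤ (Σ_{τ ∈ T} κ_τ·√(1 + log B_τ + 8 B_τ/h))²`
— against the flat size `(Σ_τ 2κ_τ√B_τ)²/h` of `‖W‖₁²/h`. [folklore] -/
theorem sum_sq_aggregate_le {h : ℕ} [NeZero h] {ι : Type*} (T : Finset ι) (B : ι → ℕ) (κ : ι → ℝ)
    (hκ : ∀ τ ∈ T, 0 ≤ κ τ) (φ : ι → ZMod h → ZMod h) (hφ : ∀ τ ∈ T, Function.Injective (φ τ))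
    (v : ι → ℕ → ℝ)
    (hv : ∀ τ ∈ T, ∀ β ∈ Icc 1 (B τ), 0 ≤ v τ β ∧ v τ β ≤ κ τ * ((β : ℝ)) ^ (-(1 / 2 : ℝ))) :
    ∑ a : ZMod h, (∑ τ ∈ T, ∑ β ∈ (Icc 1 (B τ)).filter (fun β : ℕ => φ τ (β : ZMod h) = a), v τ β) ^ 2 ≤
      (∑ τ ∈ T, κ τ * Real.sqrt (1 + Real.log (B τ) + 8 * (B τ : ℝ) / h)) ^ 2 := by
  classical
  have hh0 : (0 : ℝ) < h := by exact_mod_cast Nat.pos_of_ne_zero (NeZero.ne h)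
  have hrad : ∀ τ, 0 ≤ 1 + Real.log (B τ) + 8 * (B τ : ℝ) / h := fun τ => by
    have := Real.log_natCast_nonneg (B τ)
    positivity
  refine sum_sq_sum_le_sq_sum T _ _ (fun τ hτ => mul_nonneg (hκ τ hτ) (Real.sqrt_nonneg _)) fun τ hτ => ?_
  -- regroup the inner sum by residues and re-index along `φ τ`
  simp_rw [sum_filter_comp_eq_sum_fiber (φ τ) (B τ) (v τ)]
  rw [sum_sq_fiber_eq_of_injective (hφ τ hτ), mul_pow, Real.sq_sqrt (hrad τ)]
  exact sum_sq_classSum_le_of_le_rpow (hv τ hτ)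

/-- **Flatness of an aggregate, unit multipliers.** As `sum_sq_aggregate_le` with the class maps
`ρ ↦ u_τ·ρ`, `u_τ` a unit mod `h` (the shape `class = −(l/d₁)(m/d₂)((r+1)s)⁻¹·β`-type of the K_B sources, the
running variable `β` entering linearly). [folklore] -/
theorem sum_sq_aggregate_mul_le {h : ℕ} [NeZero h] {ι : Type*} (T : Finset ι) (B : ι → ℕ) (κ : ι → ℝ)
    (hκ : ∀ τ ∈ T, 0 ≤ κ τ) (u : ι → ZMod h) (hu : ∀ τ ∈ T, IsUnit (u τ)) (v : ι → ℕ → ℝ)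
    (hv : ∀ τ ∈ T, ∀ β ∈ Icc 1 (B τ), 0 ≤ v τ β ∧ v τ β ≤ κ τ * ((β : ℝ)) ^ (-(1 / 2 : ℝ))) :
    ∑ a : ZMod h, (∑ τ ∈ T, ∑ β ∈ (Icc 1 (B τ)).filter (fun β : ℕ => u τ * (β : ZMod h) = a), v τ β) ^ 2 ≤
      (∑ τ ∈ T, κ τ * Real.sqrt (1 + Real.log (B τ) + 8 * (B τ : ℝ) / h)) ^ 2 :=
  sum_sq_aggregate_le T B κ hκ (fun τ ρ => u τ * ρ) (fun τ hτ => (hu τ hτ).mul_right_injective) v hv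

/-- **Flatness of an aggregate, complex weights.** For complex weights `c_τ(β)` with
`‖c_τ(β)‖ ≤ κ_τ β^{-1/2}` on `[1, B_τ]` (`κ_τ ≥ 0`) and unit multipliers `u_τ`:
`Σ_{a mod h} ‖Σ_{τ ∈ T} Σ_{β : u_τ β = a} c_τ(β)‖² ≤ (Σ_τ κ_τ √(1 + log B_τ + 8B_τ/h))²`. [folklore] -/
theorem sum_norm_sq_aggregate_mul_le {h : ℕ} [NeZero h] {ι : Type*} (T : Finset ι) (B : ι → ℕ) (κ : ι → ℝ)
    (hκ : ∀ τ ∈ T, 0 ≤ κ τ) (u : ι → ZMod h) (hu : ∀ τ ∈ T, IsUnit (u τ)) (c : ι → ℕ → ℂ)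
    (hc : ∀ τ ∈ T, ∀ β ∈ Icc 1 (B τ), ‖c τ β‖ ≤ κ τ * ((β : ℝ)) ^ (-(1 / 2 : ℝ))) :
    ∑ a : ZMod h, ‖∑ τ ∈ T, ∑ β ∈ (Icc 1 (B τ)).filter (fun β : ℕ => u τ * (β : ZMod h) = a), c τ β‖ ^ 2 ≤
      (∑ τ ∈ T, κ τ * Real.sqrt (1 + Real.log (B τ) + 8 * (B τ : ℝ) / h)) ^ 2 := by
  classical
  refine le_trans (Finset.sum_le_sum fun a _ => ?_)
    (sum_sq_aggregate_mul_le T B κ hκ u hu (fun τ β => ‖c τ β‖)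
      fun τ hτ β hβ => ⟨norm_nonneg _, hc τ hτ β hβ⟩)
  refine pow_le_pow_left₀ (norm_nonneg _) ?_ 2
  refine (norm_sum_le _ _).trans (Finset.sum_le_sum fun τ _ => norm_sum_le _ _)

/-- The `ℓ¹` mass of an aggregate is the total weight of the sources (no injectivity needed):
`Σ_{a mod h} Σ_{τ ∈ T} Σ_{β : φ_τ(β) = a} v_τ(β) = Σ_τ Σ_{β ∈ [1,B_τ]} v_τ(β)` — the trivial size against which
flatness is measured (`‖W‖₁²/h` flat vs the bound of `sum_sq_aggregate_le`). [folklore] -/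
theorem sum_aggregate_eq {h : ℕ} [NeZero h] {ι : Type*} (T : Finset ι) (B : ι → ℕ)
    (φ : ι → ZMod h → ZMod h) (v : ι → ℕ → ℝ) :
    ∑ a : ZMod h, ∑ τ ∈ T, ∑ β ∈ (Icc 1 (B τ)).filter (fun β : ℕ => φ τ (β : ZMod h) = a), v τ β =
      ∑ τ ∈ T, ∑ β ∈ Icc 1 (B τ), v τ β := by
  classical
  rw [Finset.sum_comm]
  exact Finset.sum_congr rfl fun τ _ => Finset.sum_fiberwise (Icc 1 (B τ)) (fun β : ℕ => φ τ (β : ZMod h)) _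

/-- Restriction to the reduced classes: for `F ≥ 0`, `Σ_{c ∈ (ℤ/h)ˣ} F(c) ≤ Σ_{a mod h} F(a)` — the form in
which `Literature.NumberTheory.Sieve.LargeSieve.sum_units_norm_sq_largePart_eq` indexes the classes. [folklore] -/
theorem sum_units_le_sum_zmod {h : ℕ} [NeZero h] (F : ZMod h → ℝ) (hF : ∀ a, 0 ≤ F a) :
    ∑ c : (ZMod h)ˣ, F (c : ZMod h) ≤ ∑ a : ZMod h, F a := by
  classical
  rw [← Finset.sum_image (s := (Finset.univ : Finset (ZMod h)ˣ)) (g := fun c : (ZMod h)ˣ => (c : ZMod h))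
    (f := F) fun c _ c' _ hcc => Units.ext hcc]
  exact Finset.sum_le_univ_sum_of_nonneg hF

/-- **The bilinear form of flatness (the `(l, m)`-sources of K_B).** For `h ≥ 1`, a unit `t` mod `h`, outer weights
`x_l ≥ 0` on `[1, L]` and inner weights `0 ≤ y_m ≤ κ m^{-1/2}` on `[1, M]`, the weight landing in the reduced class
`c`, `W(c) = Σ_{l ≤ L} Σ_{m ≤ M, t·l·m ≡ c} x_l y_m`, satisfies
`Σ_{c ∈ (ℤ/h)ˣ} W(c)² ≤ (Σ_l x_l)²·κ²·(1 + log M + 8M/h)`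
(only `l` coprime to `h` reach a reduced class; then `m ↦ t l m` is a unit multiplier). With `x_l = |c_l|·sup|Φ̂|`,
`y_m = |c_m|` (`‖c_m‖ ≤ B_P m^{-1/2}`, `norm_mollifierCoeff_le`) this is the flatness count of OMEGA-BLUEPRINT v4 §3c
for one modulus: flat size `(Σ x)²·4κ²M/h`, loss factor `2 + h(1 + log M)/(4M)`. [folklore] -/
theorem sum_units_sq_bilinear_le {h : ℕ} [NeZero h] (L M : ℕ) {t : ZMod h} (ht : IsUnit t) {κ : ℝ}
    {x y : ℕ → ℝ} (hx : ∀ l ∈ Icc 1 L, 0 ≤ x l)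
    (hy : ∀ m ∈ Icc 1 M, 0 ≤ y m ∧ y m ≤ κ * ((m : ℝ)) ^ (-(1 / 2 : ℝ))) :
    ∑ c : (ZMod h)ˣ, (∑ l ∈ Icc 1 L, ∑ m ∈ (Icc 1 M).filter
        (fun m : ℕ => t * (l : ZMod h) * (m : ZMod h) = (c : ZMod h)), x l * y m) ^ 2 ≤
      (∑ l ∈ Icc 1 L, x l) ^ 2 * (κ ^ 2 * (1 + Real.log M + 8 * (M : ℝ) / h)) := by
  classical
  have hh0 : (0 : ℝ) < h := by exact_mod_cast Nat.pos_of_ne_zero (NeZero.ne h)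
  rcases Nat.eq_zero_or_pos M with hM0 | hM0
  · subst hM0
    simp only [Finset.Icc_eq_empty_of_lt zero_lt_one, Finset.filter_empty, Finset.sum_empty,
      Finset.sum_const_zero, zero_pow two_ne_zero, Nat.cast_zero, Real.log_zero, mul_zero, zero_div,
      add_zero]
    positivity
  have hκ : 0 ≤ κ := by
    have h1 := hy 1 (Finset.mem_Icc.2 ⟨le_rfl, by omega⟩)
    simp only [Nat.cast_one, Real.one_rpow, mul_one] at h1
    exact h1.1.trans h1.2
  have hrad : 0 ≤ 1 + Real.log M + 8 * (M : ℝ) / h := by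
    have := Real.log_natCast_nonneg M
    positivity
  set T := (Icc 1 L).filter (fun l : ℕ => IsUnit ((l : ℕ) : ZMod h)) with hT
  have hTsub : T ⊆ Icc 1 L := Finset.filter_subset _ _
  -- only `l` coprime to `h` reach a reduced class
  have hreach : ∀ c : (ZMod h)ˣ, ∑ l ∈ Icc 1 L, ∑ m ∈ (Icc 1 M).filter
      (fun m : ℕ => t * (l : ZMod h) * (m : ZMod h) = (c : ZMod h)), x l * y m =
        ∑ l ∈ T, ∑ m ∈ (Icc 1 M).filter
          (fun m : ℕ => t * (l : ZMod h) * (m : ZMod h) = (c : ZMod h)), x l * y m := by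
    intro c
    rw [hT, Finset.sum_filter]
    refine Finset.sum_congr rfl fun l _ => ?_
    split_ifs with hl
    · rfl
    · refine Finset.sum_eq_zero fun m hm => ?_
      exfalso
      apply hl
      have hm' := (Finset.mem_filter.1 hm).2
      have hc : IsUnit (t * (l : ZMod h) * (m : ZMod h)) := by rw [hm']; exact Units.isUnit c
      exact isUnit_of_mul_isUnit_right (isUnit_of_mul_isUnit_left hc)
  simp_rw [hreach]
  have hu : ∀ l ∈ T, IsUnit (t * ((l : ℕ) : ZMod h)) := fun l hl => ht.mul (Finset.mem_filter.1 hl).2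
  have hκ0 : ∀ l ∈ T, 0 ≤ x l * κ := fun l hl => mul_nonneg (hx l (hTsub hl)) hκ
  have hv : ∀ l ∈ T, ∀ m ∈ Icc 1 M, 0 ≤ x l * y m ∧ x l * y m ≤ x l * κ * ((m : ℝ)) ^ (-(1 / 2 : ℝ)) := by
    intro l hl m hm
    refine ⟨mul_nonneg (hx l (hTsub hl)) (hy m hm).1, ?_⟩
    rw [mul_assoc]
    exact mul_le_mul_of_nonneg_left (hy m hm).2 (hx l (hTsub hl))
  calc ∑ c : (ZMod h)ˣ, (∑ l ∈ T, ∑ m ∈ (Icc 1 M).filter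
          (fun m : ℕ => t * (l : ZMod h) * (m : ZMod h) = (c : ZMod h)), x l * y m) ^ 2
      ≤ ∑ a : ZMod h, (∑ l ∈ T, ∑ m ∈ (Icc 1 M).filter
          (fun m : ℕ => t * (l : ZMod h) * (m : ZMod h) = a), x l * y m) ^ 2 :=
        sum_units_le_sum_zmod (fun a : ZMod h => (∑ l ∈ T, ∑ m ∈ (Icc 1 M).filter
          (fun m : ℕ => t * (l : ZMod h) * (m : ZMod h) = a), x l * y m) ^ 2) fun _ => sq_nonneg _
    _ ≤ (∑ l ∈ T, x l * κ * Real.sqrt (1 + Real.log M + 8 * (M : ℝ) / h)) ^ 2 :=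
        sum_sq_aggregate_mul_le T (fun _ => M) (fun l => x l * κ) hκ0 (fun l => t * ((l : ℕ) : ZMod h)) hu
          (fun l m => x l * y m) hv
    _ = (∑ l ∈ T, x l) ^ 2 * (κ ^ 2 * (1 + Real.log M + 8 * (M : ℝ) / h)) := by
        rw [← Finset.sum_mul, ← Finset.sum_mul, mul_pow, mul_pow, Real.sq_sqrt hrad]
        ring
    _ ≤ (∑ l ∈ Icc 1 L, x l) ^ 2 * (κ ^ 2 * (1 + Real.log M + 8 * (M : ℝ) / h)) := by
        refine mul_le_mul_of_nonneg_right ?_ (by positivity)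
        exact pow_le_pow_left₀ (Finset.sum_nonneg fun l hl => hx l (hTsub hl))
          (Finset.sum_le_sum_of_subset_of_nonneg hTsub fun l hl _ => hx l hl) 2

end Aggregate

end Summit.Parity.GeneralizedHardyLittlewood.Theorems.BeyondDiagonalBeatsQuarter.OffDiag
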